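import Literature.Combinatorics.StablePolynomials.Homogenization
import Literature.Combinatorics.StablePolynomials.VariableInversion
import HarnessLib

/-!
# Binomially weighted windows of homogeneous parts of a stable polynomial are stable
# (Borcea–Brändén–Liggett, Lemma 4.16, general `p ≤ q`)

J. Borcea, P. Brändén, T. M. Liggett, *Negative dependence and the geometry of polynomials*, J. Amer. Math.
Soc. 22 (2009) 521–567 (arXiv:0707.2340, held `paper:arxiv-0707.2340`; numbering of the arXiv version), §4.3.2
(verbatim, arXiv p. 18):

> **Lemma 4.16.** Suppose that `f(z) = Σ_{α ∈ ℕ^n} a(α) z^α ∈ ℝ[z_1,…,z_n]` is stable of total degree at most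
> `d` and has non-negative coefficients. For `0 ≤ k ≤ d` let `E_k(z) = Σ_{|α| = k} a(α) z^α`. If
> `0 ≤ p ≤ q ≤ d`, then
> `Σ_{k=p}^{q} binom(q-p, k-p) E_k(z) y^{q-k} / binom(d, k)`                                            (4.4)
> is a stable polynomial in the variables `z_1,…,z_n,y`.
> *Proof.* Define a sequence of polynomials in `ℝ[z_1,…,z_n,y]` as follows:
> `f_1(z,y) = Σ a(α) z^α y^{d-|α|} = Σ_{k=0}^{d} E_k(z) y^{d-k}`, `f_2(z,y) = ∂^{d-q} f_1/∂y^{d-q}`,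
> `f_3(z,y) = y^q z_1^d ⋯ z_n^d f_2(z_1^{-1},…,z_n^{-1},y^{-1})`, `f_4(z,y) = ∂^p f_3/∂y^p`,
> `f_5(z,y) = y^{q-p} z_1^d ⋯ z_n^d f_4(z_1^{-1},…,z_n^{-1},y^{-1})`. By Theorem 4.5, `f_1` is a stable
> polynomial, and by the closure properties of stable polynomials (Proposition 3.1) we also have that
> `f_2,…,f_5` are stable. The polynomial `f_5` is a constant multiple of (4.4).

The case `q - p = 1` (in the form `E_{k-1} ≪ E_k`) and its uses (Cor. 4.18, Thm. 4.19) are in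
`Probability/NegativeDependence/TruncationStochasticDomination.lean`; the three-term consequence Cor. 4.17 is in
`StablePolynomials/HomogeneousPartsNewton.lean`. Both files leave the general Lemma 4.16 as a TODO; this file
proves it.

## Transposition

* The variable `y` is `X none` of `MvPolynomial (Option σ) ℝ`, the `z`-variables are `X (some i)`; (4.4) is the
  polynomial `homPartsWindow d p q f = Σ_{k=p}^{q} C(binom(q-p,k-p)/binom(d,k)) · rename some (E_k f) · y^{q-k}`
  with `E_k = homogeneousComponent k` (Mathlib); `f_1 = homogenize d f` (tree, Thm. 4.5 = tree
  `IsRealStable.homogenize`).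
* The printed chain `f_1 ↦ f_2 ↦ f_3 ↦ f_4 ↦ f_5` is followed with ONE modification: the inversions `f_3`, `f_5`
  invert only the variable `y`, and with the sign of Borcea–Brändén's Lemma 1.7 (3) (`y^m g(z, -1/y)`, tree
  `invertVar none m`, stable by tree `IsRealStable.invertVar`), instead of all variables without sign. The
  `z`-inversions of the source cancel between `f_3` and `f_5` anyway, and the signs only contribute the global
  factor `(-1)^{q-p}`: `f_5 = (-1)^{q-p} (d!/(q-p)!) · (4.4)` (`windowF5_eq_C_mul_homPartsWindow`). "Proposition 3.1"
  (closure under `∂/∂y` and inversion) is the tree's `IsUpperHalfPlaneStable.iterate_pderiv` (Gauss–Lucas) and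
  `IsRealStable.invertVar`.
* As everywhere in the tree, "stable" for a possibly vanishing polynomial is stated as "zero or real stable":
  (4.4) is the zero polynomial exactly when `E_p = ⋯ = E_q = 0` (`homPartsWindow_eq_zero_iff`), a case the
  source tacitly excludes.

## Contents

* §1 Coefficient bookkeeping: `coeff_iterate_pderiv` (`∂_i^k`), `coeff_invertVar` (tree `invertVar`),
  `coeff_rename_some_mul_X_pow`.
* §2 `homPartsWindow` (4.4) and `coeff_homPartsWindow`, `homPartsWindow_eq_zero_iff`.
* §3 The chain `f_2,…,f_5` (`windowF2`…`windowF5`), their coefficients and `y`-degrees, `windowF5_eq_C_mul_homPartsWindow`.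
* §4 **`BorceaBrandenLiggett_lemma_4_16`** (zero or real stable) and `BorceaBrandenLiggett_lemma_4_16'` (real
  stable as soon as some `E_k ≠ 0`, `p ≤ k ≤ q`).

## References

* [BorceaBrandenLiggett2007] J. Borcea, P. Brändén, T. M. Liggett, Negative dependence and the geometry of
  polynomials, J. Amer. Math. Soc. 22 (2009), 521–567; arXiv:0707.2340 — §4.3.2 Lemma 4.16, §4.1 Thm. 4.5,
  §3 Prop. 3.1.
* [BorceaBranden2009] J. Borcea, P. Brändén, The Lee–Yang and Pólya–Schur programs I, Invent. Math. 177 (2009)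
  — Lemma 1.7 (3) (inversion of one variable; tree `VariableInversion.lean`).
-/

noncomputable section

open Finset MvPolynomial

namespace Literature.Combinatorics.StablePolynomials

variable {σ : Type*}

/-! ## §1 Coefficient bookkeeping -/

section Coeff

/-- **Coefficients of an iterated partial derivative**: `[z^m] ∂_i^k g = (m_i+k)(m_i+k-1)⋯(m_i+1) · [z^{m+k e_i}] g`.
[cite: BorceaBrandenLiggett2007, §4.3.2 proof of Lemma 4.16 (`f_2 = ∂^{d-q} f_1/∂y^{d-q}`, `f_4 = ∂^p f_3/∂y^p`)] -/
theorem coeff_iterate_pderiv {R : Type*} [CommSemiring R] (i : σ) (k : ℕ) (g : MvPolynomial σ R)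
    (m : σ →₀ ℕ) :
    coeff m ((pderiv i)^[k] g) = coeff (m + Finsupp.single i k) g * ((m i + k).descFactorial k : ℕ) := by
  induction k generalizing m with
  | zero => simp
  | succ k ih =>
    rw [Function.iterate_succ_apply', coeff_pderiv, ih]
    have h1 : m + Finsupp.single i 1 + Finsupp.single i k = m + Finsupp.single i (k + 1) := by
      rw [add_assoc, ← Finsupp.single_add, add_comm 1 k]
    have h2 : (m + Finsupp.single i 1 : σ →₀ ℕ) i + k = m i + (k + 1) := by
      rw [Finsupp.add_apply, Finsupp.single_eq_same]
      ring
    rw [h1, h2, Nat.descFactorial_succ, show m i + (k + 1) - k = m i + 1 by omega]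
    push_cast
    ring

/-- **Coefficients of the inverted polynomial** `z_i^D g(…, -z_i^{-1}, …)` (`D ≥ deg_{z_i} g`): the coefficient
of `z^t` is `(-1)^{D - t_i} [z^{t'}] g` with `t'_i = D - t_i`, `t'_j = t_j` (`j ≠ i`), and `0` if `t_i > D`.
[cite: BorceaBranden2009, §1 Lemma 1.7 (3)] -/
theorem coeff_invertVar {R : Type*} [CommRing R] [DecidableEq σ] (i : σ) {D : ℕ} {g : MvPolynomial σ R}
    (hg : degreeOf i g ≤ D) (t : σ →₀ ℕ) :
    coeff t (invertVar i D g) = if t i ≤ D then (-1) ^ (D - t i) * coeff (t.update i (D - t i)) g else 0 := by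
  classical
  rw [invertVar, coeff_sum]
  simp only [coeff_monomial]
  have hdeg : ∀ s ∈ g.support, s i ≤ D := fun s hs => (degreeOf_le_iff.1 hg) s hs
  split_ifs with ht
  · set s₀ := t.update i (D - t i) with hs₀
    have hs₀i : s₀ i = D - t i := by
      rw [hs₀, Finsupp.coe_update, Function.update_self]
    have hfwd : ∀ s ∈ g.support, s.update i (D - s i) = t → s = s₀ := by
      intro s hs h
      ext j
      rcases eq_or_ne j i with rfl | hj
      · have hti : t j = D - s j := by rw [← h, Finsupp.coe_update, Function.update_self]
        rw [hs₀i, hti]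
        have := hdeg s hs
        omega
      · have htj : t j = s j := by rw [← h, Finsupp.coe_update, Function.update_of_ne hj]
        rw [hs₀, Finsupp.coe_update, Function.update_of_ne hj, htj]
    have hback : s₀.update i (D - s₀ i) = t := by
      ext j
      rcases eq_or_ne j i with rfl | hj
      · rw [Finsupp.coe_update, Function.update_self, hs₀i]
        omega
      · rw [Finsupp.coe_update, Function.update_of_ne hj, hs₀, Finsupp.coe_update, Function.update_of_ne hj]
    rw [Finset.sum_eq_single s₀ (fun b hb hne => if_neg fun h => hne (hfwd b hb h))
      (fun hnot => by rw [if_pos hback, notMem_support_iff.1 hnot, mul_zero]), if_pos hback, hs₀i]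
  · refine Finset.sum_eq_zero fun s hs => ?_
    rw [if_neg]
    intro h
    apply ht
    rw [← h, Finsupp.coe_update, Function.update_self]
    exact Nat.sub_le _ _

/-- The exponent `(α, j)` over `Option σ`: `mapDomain some α + j e_{none} = α.optionElim j`. [folklore] -/
private theorem mapDomain_some_add_single (α : σ →₀ ℕ) (j : ℕ) :
    Finsupp.mapDomain some α + Finsupp.single none j = α.optionElim j := by
  ext o
  rcases o with _ | i
  · rw [Finsupp.add_apply, Finsupp.mapDomain_notin_range _ _ (by simp), Finsupp.single_eq_same,
      Finsupp.optionElim_apply_none, zero_add]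
  · rw [Finsupp.add_apply, Finsupp.mapDomain_apply (Option.some_injective σ), Finsupp.single_eq_of_ne (by simp),
      Finsupp.optionElim_apply_some, add_zero]

/-- **Coefficients of `E(z) · y^j`**: the coefficient of `z^α y^a` in `rename some E · (X none)^j` is `[z^α] E` if
`a = j` and `0` otherwise. [cite: BorceaBrandenLiggett2007, §4.3.2 Lemma 4.16 (the terms `E_k(z) y^{q-k}`)] -/
theorem coeff_rename_some_mul_X_pow {R : Type*} [CommSemiring R] (E : MvPolynomial σ R) (j : ℕ)
    (n : Option σ →₀ ℕ) :
    coeff n (rename some E * X none ^ j) = if n none = j then coeff n.some E else 0 := by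
  classical
  induction E using MvPolynomial.induction_on' with
  | monomial α a =>
    rw [rename_monomial, X_pow_eq_monomial, monomial_mul, mul_one, coeff_monomial, coeff_monomial,
      mapDomain_some_add_single]
    by_cases h : α.optionElim j = n
    · rw [if_pos h, if_pos (by rw [← h, Finsupp.optionElim_apply_none]),
        if_pos (by rw [← h, Finsupp.some_optionElim])]
    · rw [if_neg h]
      split_ifs with h1 h2
      · exact absurd (by rw [h2, ← h1]; exact Finsupp.optionElim_some n) h
      · rfl
      · rfl
  | add p q hp hq =>
    rw [map_add, add_mul, coeff_add, hp, hq, coeff_add]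
    split_ifs <;> simp

end Coeff

/-! ## §2 The polynomial (4.4) -/

section Window

/-- **The binomially weighted window of homogeneous parts** (BBL (4.4)):
`Σ_{k=p}^{q} binom(q-p, k-p) E_k(z) y^{q-k} / binom(d, k)`, with `E_k = homogeneousComponent k f`, `y = X none`
and `z_i = X (some i)`. [cite: BorceaBrandenLiggett2007, §4.3.2 Lemma 4.16 (display (4.4))] -/
def homPartsWindow (d p q : ℕ) (f : MvPolynomial σ ℝ) : MvPolynomial (Option σ) ℝ :=
  ∑ k ∈ Finset.Icc p q, C ((((q - p).choose (k - p) : ℕ) : ℝ) / ((d.choose k : ℕ) : ℝ)) *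
    (rename some (homogeneousComponent k f) * X none ^ (q - k))

/-- Unfolding (4.4). [cite: BorceaBrandenLiggett2007, §4.3.2 Lemma 4.16 (display (4.4))] -/
theorem homPartsWindow_def (d p q : ℕ) (f : MvPolynomial σ ℝ) :
    homPartsWindow d p q f = ∑ k ∈ Finset.Icc p q, C ((((q - p).choose (k - p) : ℕ) : ℝ) / ((d.choose k : ℕ) : ℝ)) *
      (rename some (homogeneousComponent k f) * X none ^ (q - k)) := rfl

/-- **Coefficients of (4.4)**: the coefficient of `z^α y^a` is `binom(q-p,|α|-p)/binom(d,|α|) · [z^α] f` when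
`p ≤ |α| ≤ q` and `a = q - |α|`, and `0` otherwise. [cite: BorceaBrandenLiggett2007, §4.3.2 Lemma 4.16 (display
(4.4))] -/
theorem coeff_homPartsWindow (d p q : ℕ) (f : MvPolynomial σ ℝ) (n : Option σ →₀ ℕ) :
    coeff n (homPartsWindow d p q f) =
      if p ≤ n.some.degree ∧ n.some.degree ≤ q ∧ n none = q - n.some.degree then
        (((q - p).choose (n.some.degree - p) : ℕ) : ℝ) / ((d.choose n.some.degree : ℕ) : ℝ) * coeff n.some f
      else 0 := by
  classical
  rw [homPartsWindow, coeff_sum]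
  simp only [coeff_C_mul, coeff_rename_some_mul_X_pow, coeff_homogeneousComponent]
  have hterm : ∀ k ∈ Finset.Icc p q,
      (((q - p).choose (k - p) : ℕ) : ℝ) / ((d.choose k : ℕ) : ℝ) *
          (if n none = q - k then (if n.some.degree = k then coeff n.some f else 0) else 0) =
        if k = n.some.degree then
          (if n none = q - n.some.degree then
            (((q - p).choose (n.some.degree - p) : ℕ) : ℝ) / ((d.choose n.some.degree : ℕ) : ℝ) * coeff n.some f
          else 0)
        else 0 := by
    intro k _
    by_cases hk : k = n.some.degree
    · subst hk
      simp only [if_true]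
      split_ifs <;> simp
    · rw [if_neg hk]
      split_ifs with h1 h2
      · exact absurd h2.symm hk
      · rw [mul_zero]
      · rw [mul_zero]
  rw [Finset.sum_congr rfl hterm, Finset.sum_ite_eq' (Finset.Icc p q)]
  simp only [Finset.mem_Icc]
  by_cases hpq : p ≤ n.some.degree ∧ n.some.degree ≤ q
  · rw [if_pos hpq]
    by_cases h3 : n none = q - n.some.degree
    · rw [if_pos h3, if_pos ⟨hpq.1, hpq.2, h3⟩]
    · rw [if_neg h3, if_neg fun h => h3 h.2.2]
  · rw [if_neg hpq, if_neg fun h => hpq ⟨h.1, h.2.1⟩]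

/-- (4.4) vanishes exactly when the homogeneous parts `E_p,…,E_q` of `f` all vanish (for `q ≤ d`).
[cite: BorceaBrandenLiggett2007, §4.3.2 Lemma 4.16] -/
theorem homPartsWindow_eq_zero_iff {d p q : ℕ} (hqd : q ≤ d) (f : MvPolynomial σ ℝ) :
    homPartsWindow d p q f = 0 ↔ ∀ k, p ≤ k → k ≤ q → homogeneousComponent k f = 0 := by
  classical
  constructor
  · intro h k hpk hkq
    ext α
    rw [coeff_homogeneousComponent, coeff_zero]
    split_ifs with hα
    · have hc := congrArg (coeff (α.optionElim (q - k))) h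
      rw [coeff_homPartsWindow, coeff_zero, Finsupp.some_optionElim, Finsupp.optionElim_apply_none, hα,
        if_pos ⟨hpk, hkq, rfl⟩] at hc
      have h1 : (((q - p).choose (k - p) : ℕ) : ℝ) ≠ 0 := by
        exact_mod_cast (Nat.choose_pos (by omega)).ne'
      have h2 : ((d.choose k : ℕ) : ℝ) ≠ 0 := by
        exact_mod_cast (Nat.choose_pos (by omega)).ne'
      rcases mul_eq_zero.1 hc with h3 | h3
      · exact absurd h3 (div_ne_zero h1 h2)
      · exact h3
    · rfl
  · intro h
    rw [homPartsWindow]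
    refine Finset.sum_eq_zero fun k hk => ?_
    rw [Finset.mem_Icc] at hk
    rw [h k hk.1 hk.2, map_zero, zero_mul, mul_zero]

end Window

/-! ## §3 The chain `f_1 = f_H ↦ f_2 ↦ f_3 ↦ f_4 ↦ f_5` -/

section Chain

variable [DecidableEq σ]

/-- `f_2 = ∂^{d-q} f_1/∂y^{d-q}` with `f_1 = f_H = homogenize d f`. [cite: BorceaBrandenLiggett2007, §4.3.2 proof of
Lemma 4.16] -/
def windowF2 (d q : ℕ) (f : MvPolynomial σ ℝ) : MvPolynomial (Option σ) ℝ := (pderiv none)^[d - q] (homogenize d f)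

/-- `f_3 = y^q f_2(z, -1/y)` (one-variable inversion). [cite: BorceaBrandenLiggett2007, §4.3.2 proof of Lemma 4.16;
BorceaBranden2009, §1 Lemma 1.7 (3)] -/
def windowF3 (d q : ℕ) (f : MvPolynomial σ ℝ) : MvPolynomial (Option σ) ℝ := invertVar none q (windowF2 d q f)

/-- `f_4 = ∂^p f_3/∂y^p`. [cite: BorceaBrandenLiggett2007, §4.3.2 proof of Lemma 4.16] -/
def windowF4 (d p q : ℕ) (f : MvPolynomial σ ℝ) : MvPolynomial (Option σ) ℝ := (pderiv none)^[p] (windowF3 d q f)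

/-- `f_5 = y^{q-p} f_4(z, -1/y)`. [cite: BorceaBrandenLiggett2007, §4.3.2 proof of Lemma 4.16; BorceaBranden2009,
§1 Lemma 1.7 (3)] -/
def windowF5 (d p q : ℕ) (f : MvPolynomial σ ℝ) : MvPolynomial (Option σ) ℝ := invertVar none (q - p) (windowF4 d p q f)

omit [DecidableEq σ] in
/-- Coefficients of `f_2 = Σ_{k ≤ q} (d-k)!/(q-k)! E_k y^{q-k}`. [cite: BorceaBrandenLiggett2007, §4.3.2 proof of
Lemma 4.16] -/
theorem coeff_windowF2 [DecidableEq σ] (d q : ℕ) (f : MvPolynomial σ ℝ) (n : Option σ →₀ ℕ) :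
    coeff n (windowF2 d q f) =
      (if n none + (d - q) = d - n.some.degree then coeff n.some f else 0) * ((n none + (d - q)).descFactorial (d - q) : ℕ) := by
  rw [windowF2, coeff_iterate_pderiv, coeff_homogenize, Finsupp.add_apply, Finsupp.single_eq_same, Finsupp.some_add,
    Finsupp.some_single_none, add_zero]

/-- `deg_y f_2 ≤ q`. [cite: BorceaBrandenLiggett2007, §4.3.2 proof of Lemma 4.16] -/
theorem degreeOf_windowF2_le (d q : ℕ) (f : MvPolynomial σ ℝ) : degreeOf none (windowF2 d q f) ≤ q := by
  rw [degreeOf_le_iff]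
  intro n hn
  rw [mem_support_iff, coeff_windowF2] at hn
  have h1 := left_ne_zero_of_mul hn
  split_ifs at h1 with hc
  · omega
  · exact absurd rfl h1

/-- Coefficients of `f_3 = y^q f_2(z, -1/y)`. [cite: BorceaBrandenLiggett2007, §4.3.2 proof of Lemma 4.16] -/
theorem coeff_windowF3 (d q : ℕ) (f : MvPolynomial σ ℝ) (n : Option σ →₀ ℕ) :
    coeff n (windowF3 d q f) =
      if n none ≤ q then (-1) ^ (q - n none) * coeff (n.update none (q - n none)) (windowF2 d q f) else 0 := by
  rw [windowF3, coeff_invertVar none (degreeOf_windowF2_le d q f)]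

omit [DecidableEq σ] in
/-- Coefficients of `f_4 = ∂_y^p f_3`. [cite: BorceaBrandenLiggett2007, §4.3.2 proof of Lemma 4.16] -/
theorem coeff_windowF4 [DecidableEq σ] (d p q : ℕ) (f : MvPolynomial σ ℝ) (n : Option σ →₀ ℕ) :
    coeff n (windowF4 d p q f) = coeff (n + Finsupp.single none p) (windowF3 d q f) * ((n none + p).descFactorial p : ℕ) := by
  rw [windowF4, coeff_iterate_pderiv]

/-- `deg_y f_4 ≤ q - p`. [cite: BorceaBrandenLiggett2007, §4.3.2 proof of Lemma 4.16] -/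
theorem degreeOf_windowF4_le (d p q : ℕ) (f : MvPolynomial σ ℝ) : degreeOf none (windowF4 d p q f) ≤ q - p := by
  rw [degreeOf_le_iff]
  intro n hn
  rw [mem_support_iff, coeff_windowF4, coeff_windowF3, Finsupp.add_apply, Finsupp.single_eq_same] at hn
  have h1 := left_ne_zero_of_mul hn
  split_ifs at h1 with hc
  · omega
  · exact absurd rfl h1

/-- Coefficients of `f_5 = y^{q-p} f_4(z, -1/y)`. [cite: BorceaBrandenLiggett2007, §4.3.2 proof of Lemma 4.16] -/
theorem coeff_windowF5 (d p q : ℕ) (f : MvPolynomial σ ℝ) (n : Option σ →₀ ℕ) :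
    coeff n (windowF5 d p q f) =
      if n none ≤ q - p then (-1) ^ (q - p - n none) * coeff (n.update none (q - p - n none)) (windowF4 d p q f) else 0 := by
  rw [windowF5, coeff_invertVar none (degreeOf_windowF4_le d p q f)]

omit [DecidableEq σ] in
/-- The factorial bookkeeping of the chain: `(-1)^{k-p} (-1)^{q-k} · (d-k)!/(q-k)! · k!/(k-p)!
= (-1)^{q-p} (d!/(q-p)!) · binom(q-p,k-p)/binom(d,k)` for `p ≤ k ≤ q ≤ d`. [cite: BorceaBrandenLiggett2007,
§4.3.2 proof of Lemma 4.16 ("`f_5` is a constant multiple of (4.4)")] -/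
theorem chain_constant {d p q k : ℕ} (hpk : p ≤ k) (hkq : k ≤ q) (hqd : q ≤ d) :
    (-1 : ℝ) ^ (k - p) * (-1) ^ (q - k) * (((d - k).descFactorial (d - q) : ℕ) : ℝ) * ((k.descFactorial p : ℕ) : ℝ) =
      (-1) ^ (q - p) * ((d.factorial : ℝ) / ((q - p).factorial : ℝ)) *
        ((((q - p).choose (k - p) : ℕ) : ℝ) / ((d.choose k : ℕ) : ℝ)) := by
  have hsign : (-1 : ℝ) ^ (k - p) * (-1) ^ (q - k) = (-1) ^ (q - p) := by
    rw [← pow_add, show k - p + (q - k) = q - p by omega]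
  -- the four integer identities
  have h1 : (d - k).descFactorial (d - q) * (q - k).factorial = (d - k).factorial := by
    have := Nat.factorial_mul_descFactorial (show d - q ≤ d - k by omega)
    rw [show d - k - (d - q) = q - k by omega] at this
    rw [mul_comm]
    exact this
  have h2 : k.descFactorial p * (k - p).factorial = k.factorial := by
    rw [mul_comm]
    exact Nat.factorial_mul_descFactorial hpk
  have h3 : (q - p).choose (k - p) * (k - p).factorial * (q - k).factorial = (q - p).factorial := by
    have := Nat.choose_mul_factorial_mul_factorial (show k - p ≤ q - p by omega)
    rwa [show q - p - (k - p) = q - k by omega] at this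
  have h4 : d.choose k * k.factorial * (d - k).factorial = d.factorial :=
    Nat.choose_mul_factorial_mul_factorial (by omega)
  -- a product identity in ℕ
  have hN : (d - k).descFactorial (d - q) * k.descFactorial p * (q - p).factorial * d.choose k *
      ((q - k).factorial * (k - p).factorial) =
      d.factorial * (q - p).choose (k - p) * ((q - k).factorial * (k - p).factorial) := by
    calc (d - k).descFactorial (d - q) * k.descFactorial p * (q - p).factorial * d.choose k *
          ((q - k).factorial * (k - p).factorial)
        = ((d - k).descFactorial (d - q) * (q - k).factorial) * (k.descFactorial p * (k - p).factorial) *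
            (q - p).factorial * d.choose k := by ring
      _ = (d - k).factorial * k.factorial * (q - p).factorial * d.choose k := by rw [h1, h2]
      _ = (d.choose k * k.factorial * (d - k).factorial) * (q - p).factorial := by ring
      _ = d.factorial * ((q - p).choose (k - p) * (k - p).factorial * (q - k).factorial) := by rw [h4, h3]
      _ = d.factorial * (q - p).choose (k - p) * ((q - k).factorial * (k - p).factorial) := by ring
  have hR := congrArg (Nat.cast : ℕ → ℝ) hN
  push_cast at hR
  have hqp : ((q - p).factorial : ℝ) ≠ 0 := by positivity
  have hdk : ((d.choose k : ℕ) : ℝ) ≠ 0 := by exact_mod_cast (Nat.choose_pos (by omega)).ne'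
  have hqk : ((q - k).factorial : ℝ) ≠ 0 := by positivity
  have hkp : ((k - p).factorial : ℝ) ≠ 0 := by positivity
  rw [hsign, mul_assoc, mul_assoc]
  congr 1
  rw [div_mul_div_comm, eq_div_iff (mul_ne_zero hqp hdk)]
  have := mul_right_cancel₀ (mul_ne_zero hqk hkp) hR
  linear_combination this

/-- **`f_5` is a constant multiple of (4.4)**: `f_5 = (-1)^{q-p} (d!/(q-p)!) · Σ_{k=p}^{q} binom(q-p,k-p) E_k y^{q-k}
/ binom(d,k)`. [cite: BorceaBrandenLiggett2007, §4.3.2 proof of Lemma 4.16 ("The polynomial `f_5` is a constant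
multiple of (4.4)")] -/
theorem windowF5_eq_C_mul_homPartsWindow {d p q : ℕ} (hpq : p ≤ q) (hqd : q ≤ d) {f : MvPolynomial σ ℝ}
    (hd : f.totalDegree ≤ d) :
    windowF5 d p q f = C ((-1) ^ (q - p) * ((d.factorial : ℝ) / ((q - p).factorial : ℝ))) * homPartsWindow d p q f := by
  classical
  ext n
  rw [coeff_C_mul, coeff_windowF5, coeff_homPartsWindow]
  by_cases hn : n none ≤ q - p
  · rw [if_pos hn, coeff_windowF4, coeff_windowF3, Finsupp.add_apply, Finsupp.single_eq_same, Finsupp.coe_update,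
      Function.update_self, if_pos (show q - p - n none + p ≤ q by omega), coeff_windowF2, Finsupp.coe_update,
      Function.update_self]
    -- the exponent after the four operations is `n` again
    have hexp : ((n.update none (q - p - n none) + Finsupp.single none p).update none
        (q - (q - p - n none + p))) = n := by
      ext o
      rcases o with _ | i
      · rw [Finsupp.coe_update, Function.update_self]
        omega
      · rw [Finsupp.coe_update, Function.update_of_ne (Option.some_ne_none i), Finsupp.add_apply, Finsupp.coe_update,
          Function.update_of_ne (Option.some_ne_none i), Finsupp.single_apply, if_neg (Option.some_ne_none i).symm,
          add_zero]
    rw [hexp, show q - (q - p - n none + p) = n none by omega, show q - p - n none + p = q - n none by omega]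
    by_cases hc : coeff n.some f = 0
    · simp [hc]
    have hdeg : n.some.degree ≤ d := by
      by_contra h'
      exact hc (coeff_eq_zero_of_totalDegree_lt (lt_of_le_of_lt hd (lt_of_not_ge h')))
    by_cases hk : p ≤ n.some.degree ∧ n.some.degree ≤ q ∧ n none = q - n.some.degree
    · obtain ⟨hpk, hkq, hn0⟩ := hk
      rw [if_pos (show p ≤ n.some.degree ∧ n.some.degree ≤ q ∧ n none = q - n.some.degree from ⟨hpk, hkq, hn0⟩),
        if_pos (show n none + (d - q) = d - n.some.degree by omega)]
      have key := chain_constant (d := d) hpk hkq hqd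
      rw [hn0, show q - p - (q - n.some.degree) = n.some.degree - p by omega,
        show q - (q - n.some.degree) = n.some.degree by omega,
        show q - n.some.degree + (d - q) = d - n.some.degree by omega]
      linear_combination (coeff n.some f) * key
    · rw [if_neg hk]
      have hcond : ¬ (n none + (d - q) = d - n.some.degree) := by omega
      rw [if_neg hcond]
      simp
  · rw [if_neg hn, if_neg (show ¬ (p ≤ n.some.degree ∧ n.some.degree ≤ q ∧ n none = q - n.some.degree) by omega)]
    simp

end Chain

/-! ## §4 Lemma 4.16 -/

section Stability

variable [Fintype σ] [DecidableEq σ]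

omit [DecidableEq σ] in
/-- A nonzero real multiple of a real stable polynomial is real stable. [cite: BorceaBrandenLiggett2007, §3
Prop. 3.1 (closure properties of stable polynomials)] -/
private theorem isRealStable_C_mul {τ : Type*} {a : ℝ} (ha : a ≠ 0) {g : MvPolynomial τ ℝ} (hg : IsRealStable g) :
    IsRealStable (C a * g) := by
  have haC : algebraMap ℝ ℂ a ≠ 0 := by simpa using ha
  rw [IsRealStable, map_mul, map_C]
  exact (isUpperHalfPlaneStable_C haC).mul hg

omit [Fintype σ] [DecidableEq σ] in
/-- Iterated partial derivatives of a real stable polynomial are zero or real stable (Gauss–Lucas; tree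
`IsUpperHalfPlaneStable.iterate_pderiv`). [cite: BorceaBrandenLiggett2007, §3 Prop. 3.1] -/
private theorem isRealStable_iterate_pderiv {τ : Type*} [Fintype τ] [DecidableEq τ] {g : MvPolynomial τ ℝ}
    (hg : g = 0 ∨ IsRealStable g) (i : τ) (k : ℕ) :
    (pderiv i)^[k] g = 0 ∨ IsRealStable ((pderiv i)^[k] g) := by
  have hcomm : ∀ j : ℕ, map (algebraMap ℝ ℂ) ((pderiv i)^[j] g) = (pderiv i)^[j] (map (algebraMap ℝ ℂ) g) := by
    intro j
    induction j with
    | zero => rfl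
    | succ j ih => rw [Function.iterate_succ_apply', Function.iterate_succ_apply', ← pderiv_map, ih]
  rcases hg with h | h
  · left
    rw [h]
    induction k with
    | zero => rfl
    | succ k ih => rw [Function.iterate_succ_apply', ih, map_zero]
  · rcases h.iterate_pderiv i k with h0 | hst
    · left
      rw [← hcomm] at h0
      exact (map_injective _ (algebraMap ℝ ℂ).injective) (by rw [h0, map_zero])
    · right
      rw [IsRealStable, hcomm]
      exact hst

/-- **Borcea–Brändén–Liggett, Lemma 4.16.** Let `f ∈ ℝ[z_1,…,z_n]` be real stable of total degree at most `d` with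
non-negative coefficients, `E_k` its homogeneous parts, and `0 ≤ p ≤ q ≤ d`. Then
`Σ_{k=p}^{q} binom(q-p, k-p) E_k(z) y^{q-k} / binom(d, k)` is zero or a (real) stable polynomial in `z_1,…,z_n,y`.
Proof as printed: `f_1 = f_H` (Thm. 4.5), `f_2 = ∂_y^{d-q} f_1`, `f_3 = y^q f_2(z,-1/y)`, `f_4 = ∂_y^p f_3`,
`f_5 = y^{q-p} f_4(z,-1/y)` are (zero or) stable, and `f_5` is a nonzero constant multiple of the displayed
polynomial. [cite: BorceaBrandenLiggett2007, §4.3.2 Lemma 4.16] -/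
theorem BorceaBrandenLiggett_lemma_4_16 {f : MvPolynomial σ ℝ} (hf : IsRealStable f) (hnn : ∀ m, 0 ≤ coeff m f)
    {d p q : ℕ} (hd : f.totalDegree ≤ d) (hpq : p ≤ q) (hqd : q ≤ d) :
    homPartsWindow d p q f = 0 ∨ IsRealStable (homPartsWindow d p q f) := by
  have h1 : IsRealStable (homogenize d f) := hf.homogenize hnn hd
  have h2 : windowF2 d q f = 0 ∨ IsRealStable (windowF2 d q f) := isRealStable_iterate_pderiv (Or.inr h1) none (d - q)
  have h3 : windowF3 d q f = 0 ∨ IsRealStable (windowF3 d q f) :=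
    h2.imp (fun h => by rw [windowF3, h, invertVar_zero]) fun h => h.invertVar none (degreeOf_windowF2_le d q f)
  have h4 : windowF4 d p q f = 0 ∨ IsRealStable (windowF4 d p q f) := isRealStable_iterate_pderiv h3 none p
  have h5 : windowF5 d p q f = 0 ∨ IsRealStable (windowF5 d p q f) :=
    h4.imp (fun h => by rw [windowF5, h, invertVar_zero]) fun h => h.invertVar none (degreeOf_windowF4_le d p q f)
  set c : ℝ := (-1) ^ (q - p) * ((d.factorial : ℝ) / ((q - p).factorial : ℝ)) with hc
  have hc0 : c ≠ 0 := mul_ne_zero (pow_ne_zero _ (by norm_num)) (div_ne_zero (by positivity) (by positivity))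
  have hid : homPartsWindow d p q f = C c⁻¹ * windowF5 d p q f := by
    rw [windowF5_eq_C_mul_homPartsWindow hpq hqd hd, ← mul_assoc, ← C_mul, inv_mul_cancel₀ hc0, C_1, one_mul]
  rcases h5 with h | h
  · left
    rw [hid, h, mul_zero]
  · right
    rw [hid]
    exact isRealStable_C_mul (inv_ne_zero hc0) h

/-- **Lemma 4.16, non-degenerate form**: if moreover some homogeneous part `E_k`, `p ≤ k ≤ q`, of `f` is nonzero,
then (4.4) is real stable. [cite: BorceaBrandenLiggett2007, §4.3.2 Lemma 4.16] -/
theorem BorceaBrandenLiggett_lemma_4_16' {f : MvPolynomial σ ℝ} (hf : IsRealStable f) (hnn : ∀ m, 0 ≤ coeff m f)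
    {d p q : ℕ} (hd : f.totalDegree ≤ d) (hpq : p ≤ q) (hqd : q ≤ d) {k : ℕ} (hpk : p ≤ k) (hkq : k ≤ q)
    (hk : homogeneousComponent k f ≠ 0) : IsRealStable (homPartsWindow d p q f) :=
  (BorceaBrandenLiggett_lemma_4_16 hf hnn hd hpq hqd).resolve_left fun h =>
    hk ((homPartsWindow_eq_zero_iff hqd f).1 h k hpk hkq)

end Stability

end Literature.Combinatorics.StablePolynomials

end
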